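import Summits.RiemannHypothesis.RiemannHypothesis.Theses.SpectralTrace
import Summits.RiemannHypothesis.RiemannHypothesis.Theorems.SpectralTraceWindowCompactness
import Summits.RiemannHypothesis.RiemannHypothesis.Theorems.SpectralTraceFloorFeedbackDefs
import Summits.RiemannHypothesis.RiemannHypothesis.Theorems.SpectralTraceWindowStepStubBandExclusion
import Summits.RiemannHypothesis.RiemannHypothesis.Theorems.SpectralTraceWindowStepStubCrossingSum
import Summits.RiemannHypothesis.RiemannHypothesis.Theorems.SpectralTraceWindowStepStubTraceAssembly
import Summits.RiemannHypothesis.RiemannHypothesis.Theorems.SpectralTraceWindowStepStubSlopeAbove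
import Summits.RiemannHypothesis.RiemannHypothesis.Theorems.SpectralTraceWindowStepStubModelDensity
import Summits.RiemannHypothesis.RiemannHypothesis.Theorems.SpectralTraceWindowStepStubModelRegular
import HarnessLib

/-!
# Line `floor-feedback` for the crux `WindowStep` (stmt-RiemannHypothesis-14659) — lead's skeleton, cycle 1 integrated

Crux (route decl, FIXED): `SpectralTrace.WindowStep = ∀ n ≥ 2, Trace(log n) → Trace(log (n+1))`.
GOVERNING NEGATIVE LEMMA (landed, `Theorems/WindowStep/Negative/Collapse.lean`): `WindowStep ↔ (WindowTraceArch → RH)`;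
standing `Cruxes/WindowStep/Disproof.lean` v2 (§0 no kill short of ¬RH, §1 load-bearing binders, §2/§5 rigidity of healing,
§4 no target on any stub). Every line is an engine for RH from the seed; this skeleton puts the RH-strength input in ONE
named stub (`stub_quietLadder`) and EVERYTHING ELSE IS NOW A LANDED THEOREM.

Mechanism (idea card `Ideas/floor-feedback.md`, line card `Lines/floor-feedback.md`): quantise the EXPLICIT model count `Φ_A`
(`modelCount A`, primitive of the explicit window density `ρ_A = θ′/π + p_A − (1/π) Σ_{log m < A} Λ(m) m^{-1/2} cos(T log m)`)
by `⌊Φ_A + h⌋` with a feedback `h = k ⋆ fract(Φ_A + h)`, `𝓕k ≡ 1` on the band `|w| ≤ A/2π`.  Then `⌊Φ_A + h⌋ − Φ_A = k⋆b − b`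
is invisible to the window, so wherever the integer count is monotone its crossings reproduce `W` exactly; Bernstein bounds
the feedback slope, the explicit density has a `(1/2π) log|T| − C⋆` floor, so monotonicity is automatic above the handover
height `T₁(A,k)`; what is left (RH-strength or false) is a QUIET solution (no downward integer crossing below `T₁`) at every
integer level `A = log n`.

STATUS (2026-08-16, cycle 1 of this line): vocabulary = `Theorems/SpectralTraceFloorFeedbackDefs.lean` (p96232); RH-free
stubs ALL LANDED — `stub_modelDensity` p98320, `stub_modelRegular` p98679, `stub_bandExclusion` p97849, `stub_crossingSum`
p98153, `stub_traceAssembly` p98459, `stub_slopeAbove` p97948 (namespace `…Theorems.SpectralTraceWindowStep`); the only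
`sorry` is the held `stub_quietLadder : ∀ n ≥ 2, QuietRung (log n)` (= planner's `stub_quietSeed ∧ stub_quietStep`,
`quietLadder_iff_seed_and_step`).  UNCONDITIONAL COROLLARIES now available (this file, sorry-free): `wtrace_of_quietRung`
(a quiet rung at ANY level `A > 0` is an exact unit-multiplicity rung family `Trace(A)`), `windowTraceArch_of_quietRung_two`
(`QuietRung (log 2) → WindowTraceArch`, the tier-deciding sibling crux), `riemannHypothesis_of_quietLadder`.

THE COMPOSITION `WindowStep_of` (kernel-checked, no sorry): quiet ladder ⇒ (K0 + Bernstein + gluing + K2⁺, all landed) every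
integer rung `Trace(log n)` ⇒ ladder ⇒ RH (`riemannHypothesis_of_ladder`) ⇒ the step's conclusion at every `n`
(`spectralThesis_of_riemannHypothesis`) — the `←` direction of Collapse, openly.

DISPROOF USED: `Cruxes/WindowStep/Disproof.lean` v2 (re-read 2026-08-16T11:25Z): no `_false_without_` theorem bites the held
stub; §2/§5 are consistent with the line (a level change moves every crossing); §4 targets: none yet for this line.
-/

set_option linter.dupNamespace false

noncomputable section

open Complex Filter Set MeasureTheory
open scoped Real Topology BigOperators FourierTransform SchwartzMap

namespace Summit.RiemannHypothesis.RiemannHypothesis.Cruxes.WindowStep.FloorFeedback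

open Literature.NumberTheory.LFunctions
open Summit.RiemannHypothesis.RiemannHypothesis.Theses.SpectralTrace
open Summit.RiemannHypothesis.RiemannHypothesis.Theorems.FloorFeedback
open Summit.RiemannHypothesis.RiemannHypothesis.Theorems

/-! ## The one registered stub still open (`sorry` lives only here) -/

/-- **STUB · `stub_quietLadder` (RH-STRENGTH or false; the HELD stub) — a quiet rung at every integer level.**
`∀ n ≥ 2, QuietRung (log n)`: at every level `log n` some floor–feedback solution over the explicit model count `Φ_{log n}`
with an admissible kernel has no downward integer crossing below the handover height.  Equivalent to the planner's pair
`stub_quietSeed ∧ stub_quietStep` (`quietLadder_iff_seed_and_step`); implies RH (`riemannHypothesis_of_quietLadder`) and is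
implied by nothing known (ζ's ordinates are NOT quiet: `S(T)` is unbounded while a quiet family has `|N − Φ_A| ≤ ‖k‖₁+1`);
its instance `n = 2` (`QuietRung (log 2)`, finite height) implies `WindowTraceArch` UNCONDITIONALLY now
(`windowTraceArch_of_quietRung_two`) and is the line's cheapest decisive target (card K-iii). [folklore] -/
theorem stub_quietLadder : ∀ n : ℕ, 2 ≤ n → QuietRung (Real.log n) := by
  sorry

/-! ## Name-keyed statements (the landed stubs, for the record, and the held one) -/
namespace Registered

/-- Registered statement of `stub_modelDensity` (LANDED p98320). [folklore] -/
abbrev stub_modelDensity : Prop := ∀ A : ℝ, 0 < A → IsWindowDensity A (modelDensity A)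

/-- Registered statement of `stub_modelRegular` (LANDED p98679). [folklore] -/
abbrev stub_modelRegular : Prop :=
  ∀ A : ℝ, Continuous (modelDensity A) ∧ (∀ T : ℝ, HasDerivAt (modelCount A) (modelDensity A T) T) ∧
    (∃ C : ℝ, ∀ T : ℝ, |modelDensity A T| ≤ C * Real.log (2 + |T|)) ∧
    1 ≤ floorHeight A ∧ DensityFloor (modelDensity A) (floorHeight A) (floorConst A)

/-- Registered statement of `stub_bandExclusion` (LANDED p97849). [folklore] -/
abbrev stub_bandExclusion : Prop :=
  ∀ (A : ℝ) (g : ℝ → ℂ) (k : 𝓢(ℝ, ℝ)) (b : ℝ → ℝ) (B : ℝ), IsWeilTest g → tsupport g ⊆ Icc (-A) A →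
    (∀ w : ℝ, |w| ≤ A / (2 * π) → 𝓕 (fun T : ℝ => ((k T : ℝ) : ℂ)) w = 1) →
    Measurable b → (∀ s : ℝ, |b s| ≤ B) →
    ∫ T : ℝ, weilMellin g (1 / 2 + (T : ℂ) * I) * ((∫ s : ℝ, k (T - s) * b s : ℝ) : ℂ) =
      ∫ T : ℝ, weilMellin g (1 / 2 + (T : ℂ) * I) * ((b T : ℝ) : ℂ)

/-- Registered statement of `stub_crossingSum` (LANDED p98153). [folklore] -/
abbrev stub_crossingSum : Prop :=
  ∀ (G : ℝ → ℝ) (F F' : ℝ → ℂ) (C L : ℝ), Continuous G → Monotone (fun T : ℝ => ⌊G T⌋) →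
    Tendsto G atTop atTop → Tendsto G atBot atBot → (∀ T : ℝ, |G T| ≤ L * (1 + T ^ 2)) →
    (∀ T : ℝ, HasDerivAt F (F' T) T) → Continuous F' →
    (∀ T : ℝ, ‖F T‖ ≤ C / (1 + T ^ 2) ^ 2) → (∀ T : ℝ, ‖F' T‖ ≤ C / (1 + T ^ 2) ^ 2) →
    HasSum (fun j : ℤ => F (sInf {T : ℝ | (j : ℝ) ≤ G T})) (-∫ T : ℝ, F' T * ((⌊G T⌋ : ℝ) : ℂ))

/-- The planner's K2⁺ statement, definition-free form (target of `stub_traceAssembly`). [folklore] -/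
abbrev quietTraceStatement : Prop :=
  ∀ (A : ℝ) (Φ ρ h : ℝ → ℝ) (k : 𝓢(ℝ, ℝ)), 0 < A →
    (∀ g : ℝ → ℂ, IsWeilTest g → tsupport g ⊆ Icc (-A) A →
      Integrable (fun T : ℝ => weilMellin g (1 / 2 + (T : ℂ) * I) * ((ρ T : ℝ) : ℂ)) ∧
      ∫ T : ℝ, weilMellin g (1 / 2 + (T : ℂ) * I) * ((ρ T : ℝ) : ℂ) = weilFunctional g) →
    Continuous ρ → (∀ T : ℝ, HasDerivAt Φ (ρ T) T) →
    (∃ C : ℝ, ∀ T : ℝ, |ρ T| ≤ C * Real.log (2 + |T|)) →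
    (∀ w : ℝ, |w| ≤ A / (2 * π) → 𝓕 (fun T : ℝ => ((k T : ℝ) : ℂ)) w = 1) →
    Continuous h → (∀ T : ℝ, h T = ∫ s : ℝ, k (T - s) * Int.fract (Φ s + h s)) →
    Monotone (fun T : ℝ => ⌊Φ T + h T⌋) →
    Tendsto (fun T : ℝ => Φ T + h T) atTop atTop → Tendsto (fun T : ℝ => Φ T + h T) atBot atBot →
    ∃ (ι : Type) (γ : ι → ℝ), ∀ g : ℝ → ℂ, IsWeilTest g → tsupport g ⊆ Icc (-A) A →
      HasSum (fun i => weilMellin g (1 / 2 + (γ i : ℂ) * I)) (weilFunctional g)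

/-- Registered statement of `stub_traceAssembly` (LANDED p98459). [folklore] -/
abbrev stub_traceAssembly : Prop := stub_bandExclusion → stub_crossingSum → quietTraceStatement

/-- Registered statement of `stub_slopeAbove` (LANDED p97948). [folklore] -/
abbrev stub_slopeAbove : Prop :=
  ∀ (Φ ρ h : ℝ → ℝ) (k : 𝓢(ℝ, ℝ)) (T₀ C : ℝ), 1 ≤ T₀ → (∀ T : ℝ, HasDerivAt Φ (ρ T) T) →
    (∀ T : ℝ, T₀ ≤ |T| → Real.log |T| / (2 * π) - C ≤ ρ T) →
    Continuous h → (∀ T : ℝ, h T = ∫ s : ℝ, k (T - s) * Int.fract (Φ s + h s)) →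
    (∀ T : ℝ, ∃ d : ℝ, HasDerivAt h d T ∧ |d| ≤ (∫ x : ℝ, |deriv (fun y : ℝ => k y) x|) / 2) ∧
    StrictMonoOn (fun T : ℝ => Φ T + h T)
      (Ici (max T₀ (Real.exp (2 * π * C + π * ∫ x : ℝ, |deriv (fun y : ℝ => k y) x|)))) ∧
    StrictMonoOn (fun T : ℝ => Φ T + h T)
      (Iic (-max T₀ (Real.exp (2 * π * C + π * ∫ x : ℝ, |deriv (fun y : ℝ => k y) x|)))) ∧
    Tendsto (fun T : ℝ => Φ T + h T) atTop atTop ∧ Tendsto (fun T : ℝ => Φ T + h T) atBot atBot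

/-- Registered statement of `stub_quietLadder` (HELD). [folklore] -/
abbrev stub_quietLadder : Prop := ∀ n : ℕ, 2 ≤ n → QuietRung (Real.log n)

end Registered

/-! ## The six RH-free stubs ARE landed theorems (kernel-checked discharge of the registered statements) -/

/-- K0a holds (p98320). [folklore] -/
theorem stub_modelDensity_holds : Registered.stub_modelDensity := SpectralTraceWindowStep.stub_modelDensity

/-- K0b holds (p98679). [folklore] -/
theorem stub_modelRegular_holds : Registered.stub_modelRegular := SpectralTraceWindowStep.stub_modelRegular

/-- K2a holds (p97849). [folklore] -/
theorem stub_bandExclusion_holds : Registered.stub_bandExclusion := SpectralTraceWindowStep.stub_bandExclusion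

/-- K2b holds (p98153). [folklore] -/
theorem stub_crossingSum_holds : Registered.stub_crossingSum := SpectralTraceWindowStep.stub_crossingSum

/-- K2c holds (p98459). [folklore] -/
theorem stub_traceAssembly_holds : Registered.stub_traceAssembly := SpectralTraceWindowStep.stub_traceAssembly

/-- Bernstein holds (p97948). [folklore] -/
theorem stub_slopeAbove_holds : Registered.stub_slopeAbove := SpectralTraceWindowStep.stub_slopeAbove

/-! ## Sorry-free glue -/

/-- RESHAPE GLUE (quiet stubs): the held `stub_quietLadder` is exactly the planner's `stub_quietSeed ∧ stub_quietStep`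
(plain induction; casts by `Nat.cast_succ`). [folklore] -/
theorem quietLadder_iff_seed_and_step :
    Registered.stub_quietLadder ↔
      (QuietRung (Real.log 2) ∧ ∀ n : ℕ, 2 ≤ n → QuietRung (Real.log n) → QuietRung (Real.log (n + 1))) := by
  constructor
  · intro hL
    refine ⟨by simpa using hL 2 le_rfl, fun n hn _ => ?_⟩
    simpa [Nat.cast_succ] using hL (n + 1) (by omega)
  · rintro ⟨hSeed, hStep⟩ n hn
    induction n, hn using Nat.le_induction with
    | base => simpa using hSeed
    | succ m hm ih => simpa [Nat.cast_succ] using hStep m hm ih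

/-- GLUING: monotonicity of the integer count on `[-T₁, T₁]` and strict monotonicity of `Φ + h` on the two rays beyond
`T₁` give a monotone integer count on `ℝ`. [folklore] -/
theorem monotone_floor_of_pieces {G : ℝ → ℝ} {T₁ : ℝ} (hT₁ : 0 ≤ T₁)
    (hmid : MonotoneOn (fun T => ⌊G T⌋) (Icc (-T₁) T₁))
    (hup : StrictMonoOn G (Ici T₁)) (hdown : StrictMonoOn G (Iic (-T₁))) :
    Monotone fun T => ⌊G T⌋ := by
  have m1 : MonotoneOn (fun T => ⌊G T⌋) (Ici T₁) :=
    fun a ha b hb hab => Int.floor_le_floor (hup.monotoneOn ha hb hab)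
  have m2 : MonotoneOn (fun T => ⌊G T⌋) (Iic (-T₁)) :=
    fun a ha b hb hab => Int.floor_le_floor (hdown.monotoneOn ha hb hab)
  have hle : -T₁ ≤ T₁ := by linarith
  have m01 : MonotoneOn (fun T => ⌊G T⌋) (Icc (-T₁) T₁ ∪ Ici T₁) :=
    MonotoneOn.union_right hmid m1 (isGreatest_Icc hle) isLeast_Ici
  rw [Icc_union_Ici_eq_Ici hle] at m01
  exact MonotoneOn.Iic_union_Ici m2 m01

/-- **EXACT SYNTHESIS FROM ANY QUIET SOLUTION (unconditional).** For a window density `ρ` at level `A > 0` (continuous,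
`O(log)`, with a density floor from `T₀ ≥ 1` on) with primitive `Φ`, an admissible kernel `k` and a floor–feedback solution
`h` whose integer count is monotone on `[-T₁, T₁]`, `T₁ = handover T₀ C k`: the first crossings form an exact rung family
`Trace(A)`.  (K0-free form of the rung theorem: Bernstein p97948 + gluing + K2⁺ p97849/p98153/p98459.) [folklore] -/
theorem wtrace_of_quietSolution {A : ℝ} (hA : 0 < A) {Φ ρ h : ℝ → ℝ} {k : 𝓢(ℝ, ℝ)} {T₀ C : ℝ}
    (hT₀ : 1 ≤ T₀) (hwd : IsWindowDensity A ρ) (hcont : Continuous ρ) (hderiv : ∀ T : ℝ, HasDerivAt Φ (ρ T) T)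
    (hlog : ∃ C' : ℝ, ∀ T : ℝ, |ρ T| ≤ C' * Real.log (2 + |T|)) (hfloor : DensityFloor ρ T₀ C)
    (hk : IsFeedbackKernel A k) (hfb : IsFloorFeedback Φ h k)
    (hmono : MonotoneOn (fun T : ℝ => ⌊Φ T + h T⌋) (Icc (-handover T₀ C k) (handover T₀ C k))) : WTrace A := by
  obtain ⟨-, hup, hdown, htop, hbot⟩ :=
    SpectralTraceWindowStep.stub_slopeAbove Φ ρ h k T₀ C hT₀ hderiv hfloor hfb.1 hfb.2
  have hall : Monotone fun T : ℝ => ⌊Φ T + h T⌋ :=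
    monotone_floor_of_pieces (G := fun T => Φ T + h T) (handover_pos _ _ _).le hmono hup hdown
  exact SpectralTraceWindowStep.stub_traceAssembly SpectralTraceWindowStep.stub_bandExclusion
    SpectralTraceWindowStep.stub_crossingSum A Φ ρ h k hA hwd hcont hderiv hlog hk hfb.1 hfb.2 hall htop hbot

/-- **ONE RUNG (unconditional): a quiet rung at level `A > 0` is an exact rung family `Trace(A)`** (explicit model package
p98320/p98679 + `wtrace_of_quietSolution`). [folklore] -/
theorem wtrace_of_quietRung {A : ℝ} (hA : 0 < A) (hq : QuietRung A) : WTrace A := by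
  obtain ⟨h, k, hk, hfb, hmono⟩ := hq
  obtain ⟨hcont, hderiv, hlog, h1, hfloor⟩ := SpectralTraceWindowStep.stub_modelRegular A
  exact wtrace_of_quietSolution hA h1 (SpectralTraceWindowStep.stub_modelDensity A hA) hcont hderiv hlog hfloor hk hfb
    hmono

/-- **`QuietRung (log 2) → WindowTraceArch` (unconditional):** the `n = 2` instance of the held stub already gives the
archimedean rung, the tier-deciding sibling crux `stmt-RiemannHypothesis-11195`. [folklore] -/
theorem windowTraceArch_of_quietRung_two (hq : QuietRung (Real.log 2)) : WindowTraceArch :=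
  wtrace_of_quietRung (Real.log_pos (by norm_num)) hq

/-- **`QuietRung (log 3) → WindowTracePrime2` (unconditional):** the `n = 3` instance gives the first prime rung, the sibling
crux `stmt-RiemannHypothesis-11196`. [folklore] -/
theorem windowTracePrime2_of_quietRung_three (hq : QuietRung (Real.log 3)) : WindowTracePrime2 :=
  wtrace_of_quietRung (Real.log_pos (by norm_num)) hq

/-- The quiet ladder proves RH (exact rungs at every integer level dominate every window; then
`riemannHypothesis_of_ladder`). [folklore] -/
theorem riemannHypothesis_of_quietLadder (hL : Registered.stub_quietLadder) : _root_.RiemannHypothesis := by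
  have hr : ∀ n : ℕ, 2 ≤ n → WTrace (Real.log n) := fun n hn =>
    wtrace_of_quietRung (Real.log_pos (by exact_mod_cast (by omega : 1 < n))) (hL n hn)
  refine Summit.RiemannHypothesis.RiemannHypothesis.Theorems.riemannHypothesis_of_ladder fun A _ => ?_
  obtain ⟨n, hn⟩ := exists_nat_ge (Real.exp A)
  obtain ⟨ι, γ, hγ⟩ := hr (n + 2) (by omega)
  have hpos : (0 : ℝ) < ((n + 2 : ℕ) : ℝ) := by positivity
  have hAn : A ≤ Real.log ((n + 2 : ℕ) : ℝ) := by
    rw [Real.le_log_iff_exp_le hpos]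
    push_cast
    linarith
  exact ⟨ι, γ, fun g hg hgs => hγ g hg (hgs.trans (Icc_subset_Icc (neg_le_neg hAn) hAn))⟩

/-! ## The kernel-checked composition: the held stub implies the crux, by name -/

/-- **The line concludes the crux BY NAME** (no `sorry` outside the held stub): quiet ladder ⇒ (landed K0 + Bernstein +
gluing + K2⁺) every integer rung `Trace(log n)`; the ladder ⇒ RH (`riemannHypothesis_of_ladder`); RH ⇒ the conclusion
`Trace(log (n+1))` of the step at every `n` (`spectralThesis_of_riemannHypothesis`) — the `←` direction of the landed Collapse
lemma, openly. [folklore] -/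
theorem WindowStep_of (hL : Registered.stub_quietLadder) :
    Summit.RiemannHypothesis.RiemannHypothesis.Theses.SpectralTrace.WindowStep := by
  have hRH : _root_.RiemannHypothesis := riemannHypothesis_of_quietLadder hL
  intro n _ _
  obtain ⟨ι, γ, hγ⟩ :=
    Summit.RiemannHypothesis.RiemannHypothesis.Theorems.spectralThesis_of_riemannHypothesis hRH
  exact ⟨ι, γ, fun g hg _ => hγ g hg⟩

/-- Wiring check: the sorried held stub feeds `WindowStep_of` as stated (an `example`, so that no sorry-tainted DECLARATION
of this file has the crux as its type). -/
example : Summit.RiemannHypothesis.RiemannHypothesis.Theses.SpectralTrace.WindowStep := WindowStep_of stub_quietLadder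

end Summit.RiemannHypothesis.RiemannHypothesis.Cruxes.WindowStep.FloorFeedback

end
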